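import Mathlib
import Summits.Ventures.HodgeRepro2.T5FiniteZerosCharacters

/-!
# T5FiniteZerosUnion — S7 with the count: finitely many measures `m_i ≠ 0` on `ℤ_p` kill, jointly, only
finitely many characters, at most `Σ_i deg P_i` of them

Cell pub-hodge-repro2, Tier 5 support (seat p7; route/T5-CHECK-G-p7.md §3 S5 / S7). S7 reads
«∏_i L(1, λ_iν) ≠ 0 for ν ∉ ⋃_i Z_i^{-1}, |⋃| ≤ Σ_i deg P_i». With T5FiniteZerosCharacters (each
`Z_i := {ν : ∫ν dm_i = 0}` finite, `#Z_i ≤ deg P_i`) this is the union bound: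

* `finite_biUnion_zeroSet`: `⋃_{i ∈ I} Z_i` is finite;
* `exists_ncard_biUnion_le_sum_natDegree`: there are non-zero polynomials `P_i` with
  `#(⋃_{i ∈ I} Z_i) ≤ Σ_{i ∈ I} deg P_i`;
* `eventually_forall_map_ne_zero`: for all but finitely many continuous `ν`, `∫ν dm_i ≠ 0` for every `i`.

Mathlib + T5FiniteZerosCharacters (hence p8's T5FiniteZeros).
-/

namespace Summit.Ventures.HodgeRepro2.T5FiniteZerosUnion

open PadicInt Filter Topology
open Summit.Ventures.HodgeRepro2

/-- The union bound for `ncard` over a finite index set: `#(⋃_{i ∈ I} s i) ≤ Σ_{i ∈ I} #(s i)`. -/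
theorem ncard_biUnion_le_sum {α ι : Type*} (I : Finset ι) (s : ι → Set α) :
    (⋃ i ∈ I, s i).ncard ≤ ∑ i ∈ I, (s i).ncard := by
  classical
  induction I using Finset.induction_on with
  | empty => simp
  | insert a I ha ih =>
    rw [Finset.set_biUnion_insert, Finset.sum_insert ha]
    exact (Set.ncard_union_le _ _).trans (Nat.add_le_add_left ih _)

section ZeroSet

variable {p : ℕ} [hp : Fact p.Prime] {R : Type*} [NormedCommRing R]

/-- `Z_i := {ν continuous : ∫ν dm_i = 0}`. -/
def zeroSet (m : C(ℤ_[p], R) →ₗ[R] R) : Set {κ : AddChar ℤ_[p] R // Continuous κ} :=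
  {κ | m ⟨κ.1, κ.2⟩ = 0}

/-- Membership in `Z_i`. -/
@[simp] theorem mem_zeroSet (m : C(ℤ_[p], R) →ₗ[R] R) (κ : {κ : AddChar ℤ_[p] R // Continuous κ}) :
    κ ∈ zeroSet m ↔ m ⟨κ.1, κ.2⟩ = 0 := Iff.rfl

end ZeroSet

variable {p : ℕ} [hp : Fact p.Prime]
variable {R : Type*} [NormedCommRing R] [Algebra ℤ_[p] R] [IsBoundedSMul ℤ_[p] R]
  [IsUltrametricDist R] [CompleteSpace R] [IsLinearTopology R R] [IsDomain R]
  [IsDiscreteValuationRing R] [IsAdicComplete (IsLocalRing.maximalIdeal R) R]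
variable {ι : Type*}

/-- S7, finiteness: `⋃_{i ∈ I} Z_i` is finite when every `m_i ≠ 0` is continuous. -/
theorem finite_biUnion_zeroSet (I : Finset ι) (m : ι → (C(ℤ_[p], R) →ₗ[R] R))
    (hm : ∀ i ∈ I, Continuous (m i)) (hne : ∀ i ∈ I, m i ≠ 0) :
    (⋃ i ∈ I, zeroSet (m i)).Finite :=
  I.finite_toSet.biUnion fun i hi =>
    T5FiniteZerosCharacters.finite_zeroSet_addChar (m i) (hm i hi) (hne i hi)

/-- S7, the count: there are non-zero polynomials `P_i` (the Weierstrass polynomials of the `f_{m_i}`)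
with `#(⋃_{i ∈ I} Z_i) ≤ Σ_{i ∈ I} deg P_i`. -/
theorem exists_ncard_biUnion_le_sum_natDegree (I : Finset ι) (m : ι → (C(ℤ_[p], R) →ₗ[R] R))
    (hm : ∀ i ∈ I, Continuous (m i)) (hne : ∀ i ∈ I, m i ≠ 0) :
    ∃ P : ι → Polynomial R, (∀ i ∈ I, P i ≠ 0) ∧
      (⋃ i ∈ I, zeroSet (m i)).ncard ≤ ∑ i ∈ I, (P i).natDegree := by
  classical
  have h : ∀ i : ι, ∃ P : Polynomial R, i ∈ I → P ≠ 0 ∧ (zeroSet (m i)).ncard ≤ P.natDegree := by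
    intro i
    by_cases hi : i ∈ I
    · obtain ⟨P, hP0, hP⟩ :=
        T5FiniteZerosCharacters.exists_ncard_zeroSet_le_natDegree (m i) (hm i hi) (hne i hi)
      exact ⟨P, fun _ => ⟨hP0, hP⟩⟩
    · exact ⟨0, fun h => absurd h hi⟩
  choose P hP using h
  refine ⟨P, fun i hi => (hP i hi).1, ?_⟩
  calc (⋃ i ∈ I, zeroSet (m i)).ncard ≤ ∑ i ∈ I, (zeroSet (m i)).ncard :=
        ncard_biUnion_le_sum I fun i => zeroSet (m i)
    _ ≤ ∑ i ∈ I, (P i).natDegree := Finset.sum_le_sum fun i hi => (hP i hi).2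

/-- S7, cofinite form: for all but finitely many continuous characters `ν`, `∫ν dm_i ≠ 0` for every
`i ∈ I` (so `∏_i ∫ν dm_i ≠ 0`). -/
theorem eventually_forall_map_ne_zero (I : Finset ι) (m : ι → (C(ℤ_[p], R) →ₗ[R] R))
    (hm : ∀ i ∈ I, Continuous (m i)) (hne : ∀ i ∈ I, m i ≠ 0) :
    ∀ᶠ κ : {κ : AddChar ℤ_[p] R // Continuous κ} in cofinite, ∀ i ∈ I, m i ⟨κ.1, κ.2⟩ ≠ 0 := by
  rw [Filter.eventually_cofinite]
  refine (finite_biUnion_zeroSet I m hm hne).subset ?_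
  intro κ hκ
  simp only [Set.mem_setOf_eq, not_forall, not_not] at hκ
  obtain ⟨i, hi, h0⟩ := hκ
  exact Set.mem_biUnion hi h0

end Summit.Ventures.HodgeRepro2.T5FiniteZerosUnion
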